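import Mathlib.Logic.Equiv.Basic
import Mathlib.GroupTheory.Perm.Basic
import Mathlib.Tactic.Group
import Literature.AnabelianGeometry.SemiGraphs.Temperoids
import HarnessLib

/-!
# Semi-graphs of anabelioids, §3: proof of the free-group example of Remark 3.1.6

Mochizuki, *Semi-graphs of anabelioids*, Publ. RIMS **42** (2006), §3, Remark 3.1.6 (manuscript
p. 34) [cite: MochizukiSemiAnbd2006, Rmk 3.1.6 p.34]: "if `Π` is a [discrete] free group on generators
`e₁, e₂`, and `H ⊆ Π` is the subgroup generated by elements of the form `e₂ⁿ · e₁ · e₂⁻ⁿ`, where `n`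
ranges over the positive integers, then conjugation by `e₂` determines an endomorphism `H → H` …
which is not an automorphism."  PROOF-ONLY companion of `Temperoids.lean` (abc-iut-L3-t2): the named
fact `FreeGroupEndoNotAuto` is DISCHARGED here (`FreeGroupEndoNotAuto_holds`), no new definition.

Proof.  `e₂ H e₂⁻¹ ⊆ H` because conjugation by `e₂` maps the generator `e₂ⁿ⁺¹ e₁ e₂⁻⁽ⁿ⁺¹⁾` to the
generator with `n + 1` in place of `n`.  `e₂⁻¹ H e₂ ⊄ H` because `e₂⁻¹ (e₂ e₁ e₂⁻¹) e₂ = e₁ ∉ H`: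
under the homomorphism `F₂ → Perm ℤ`, `e₁ ↦ swap 0 1`, `e₂ ↦ (x ↦ x + 1)`, every generator of `H`
— hence every element of `H` — fixes `0` (the swap is conjugated away to `{-(n+1), -n}`), whereas
`e₁` moves `0` to `1`.  Nothing here takes a side on [IUTchIII] Cor. 3.12.
-/

namespace Literature.AnabelianGeometry.SemiGraphs

open Equiv

/-- The translation `x ↦ x + 1` of `ℤ`, iterated `k` times, is `x ↦ x + k`. [folklore] -/
private theorem addRight_one_pow_apply (k : ℕ) (x : ℤ) :
    ((Equiv.addRight (1 : ℤ)) ^ k) x = x + k := by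
  induction k generalizing x with
  | zero => simp
  | succ k ih =>
    rw [pow_succ, Perm.mul_apply, Equiv.coe_addRight, ih]
    push_cast
    ring

/-- **[SemiAnbd] Remark 3.1.6, the example** (p. 34) — DISCHARGE of the named fact
`FreeGroupEndoNotAuto` of `Temperoids.lean`: for `H = ⟨e₂ⁿ⁺¹ e₁ e₂⁻⁽ⁿ⁺¹⁾ : n ∈ ℕ⟩ ⊆ F₂`,
`e₂ H e₂⁻¹ ⊆ H` but `e₂⁻¹ H e₂ ⊄ H`. [cite: MochizukiSemiAnbd2006, Rmk 3.1.6 p.34] -/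
theorem FreeGroupEndoNotAuto_holds : FreeGroupEndoNotAuto := by
  -- unfold the `let`s of the statement
  show (∀ h ∈ Subgroup.closure (Set.range fun n : ℕ =>
          (FreeGroup.of 1 : FreeGroup (Fin 2)) ^ (n + 1) * FreeGroup.of 0 *
            ((FreeGroup.of 1 : FreeGroup (Fin 2)) ^ (n + 1))⁻¹),
        FreeGroup.of 1 * h * (FreeGroup.of 1)⁻¹ ∈ Subgroup.closure (Set.range fun n : ℕ =>
          (FreeGroup.of 1 : FreeGroup (Fin 2)) ^ (n + 1) * FreeGroup.of 0 *
            ((FreeGroup.of 1 : FreeGroup (Fin 2)) ^ (n + 1))⁻¹)) ∧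
      ¬ ∀ h ∈ Subgroup.closure (Set.range fun n : ℕ =>
          (FreeGroup.of 1 : FreeGroup (Fin 2)) ^ (n + 1) * FreeGroup.of 0 *
            ((FreeGroup.of 1 : FreeGroup (Fin 2)) ^ (n + 1))⁻¹),
        (FreeGroup.of 1)⁻¹ * h * FreeGroup.of 1 ∈ Subgroup.closure (Set.range fun n : ℕ =>
          (FreeGroup.of 1 : FreeGroup (Fin 2)) ^ (n + 1) * FreeGroup.of 0 *
            ((FreeGroup.of 1 : FreeGroup (Fin 2)) ^ (n + 1))⁻¹)
  set e₁ : FreeGroup (Fin 2) := FreeGroup.of 0 with he₁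
  set e₂ : FreeGroup (Fin 2) := FreeGroup.of 1 with he₂
  set S : Set (FreeGroup (Fin 2)) := Set.range fun n : ℕ => e₂ ^ (n + 1) * e₁ * (e₂ ^ (n + 1))⁻¹
    with hS
  set H : Subgroup (FreeGroup (Fin 2)) := Subgroup.closure S with hH
  refine ⟨?_, ?_⟩
  · -- `e₂ H e₂⁻¹ ⊆ H`: conjugation by `e₂` maps `S` into `S`
    have hmap : H.map (MulAut.conj e₂).toMonoidHom ≤ H := by
      rw [hH, MonoidHom.map_closure]
      refine Subgroup.closure_mono ?_
      rintro _ ⟨_, ⟨n, rfl⟩, rfl⟩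
      refine ⟨n + 1, ?_⟩
      simp only [MulEquiv.coe_toMonoidHom, MulAut.conj_apply]
      rw [pow_succ e₂ (n + 1)]
      group
    intro h hh
    exact hmap ⟨h, hh, rfl⟩
  · -- `e₂⁻¹ (e₂ e₁ e₂⁻¹) e₂ = e₁ ∉ H`
    intro hall
    have hg0 : e₂ ^ (0 + 1) * e₁ * (e₂ ^ (0 + 1))⁻¹ ∈ H := Subgroup.subset_closure ⟨0, rfl⟩
    have he₁H : e₁ ∈ H := by
      have := hall _ hg0
      simp only [zero_add, pow_one] at this
      rwa [show e₂⁻¹ * (e₂ * e₁ * e₂⁻¹) * e₂ = e₁ by group] at this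
    -- the permutation representation `e₁ ↦ swap 0 1`, `e₂ ↦ (· + 1)`
    let φ : FreeGroup (Fin 2) →* Perm ℤ :=
      FreeGroup.lift fun i : Fin 2 => if i = 0 then Equiv.swap 0 1 else Equiv.addRight 1
    have hφ₁ : φ e₁ = Equiv.swap 0 1 := by simp [φ, he₁]
    have hφ₂ : φ e₂ = Equiv.addRight 1 := by simp [φ, he₂]
    -- every element of `H` fixes `0`
    have hfix : ∀ h ∈ H, φ h 0 = 0 := by
      intro h hh
      rw [hH] at hh
      induction hh using Subgroup.closure_induction with
      | mem x hx =>
        obtain ⟨n, rfl⟩ := hx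
        rw [map_mul, map_mul, map_inv, map_pow, hφ₁, hφ₂, Perm.mul_apply, Perm.mul_apply]
        set y : ℤ := ((Equiv.addRight (1 : ℤ)) ^ (n + 1))⁻¹ 0 with hy
        have hy0 : ((Equiv.addRight (1 : ℤ)) ^ (n + 1)) y = 0 := by
          rw [hy, Perm.coe_inv, Equiv.apply_symm_apply]
        have hyval : y = -((n : ℤ) + 1) := by
          have := addRight_one_pow_apply (n + 1) y
          rw [hy0] at this
          push_cast at this
          linarith
        have hswap : Equiv.swap (0 : ℤ) 1 y = y :=
          Equiv.swap_apply_of_ne_of_ne (by rw [hyval]; omega) (by rw [hyval]; omega)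
        rw [hswap, hy0]
      | one => simp
      | mul x y _ _ ihx ihy => rw [map_mul, Perm.mul_apply, ihy, ihx]
      | inv x _ ihx =>
        rw [map_inv, Perm.coe_inv]
        conv_lhs => rw [← ihx]
        exact Equiv.symm_apply_apply _ 0
    have := hfix e₁ he₁H
    rw [hφ₁, Equiv.swap_apply_left] at this
    exact one_ne_zero this

end Literature.AnabelianGeometry.SemiGraphs
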